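import Literature.NumberTheory.GaloisRepresentations.ContinuousH1SahNormal
import Literature.NumberTheory.EllipticCurves.DivisionField
import Literature.NumberTheory.EllipticCurves.GeomPointsGaloisModule
import Literature.NumberTheory.EllipticCurves.BSDInvariantsProofs
import Literature.NumberTheory.EllipticCurves.KummerImageIsotropyProofs
import Literature.NumberTheory.EllipticCurves.TwoPowerTorsion
import Summits.BirchSwinnertonDyer.BirchSwinnertonDyer.Theorems.SylvesterTwoHeegnerIndexUpperOffV0EisensteinTorsion
import Summits.BirchSwinnertonDyer.BirchSwinnertonDyer.Theorems.SylvesterTwoHeegnerIndexCMNormForm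
import HarnessLib

/-!
# K7t crux `UpperOffV0HSY` (item 19581), first lemma: restriction to the `2^M`-division field is
# injective on `H¹` for the curves `y² = x³ − 432p²`

Route `SylvesterTwoHeegnerIndex` (cell bsd-cm, rung K7t, CornerF at `p = 2`, class 𝒞_HSY).  This file
proves the REGISTERED STUB `stub_res_injective_divisionField_twoPow` of the off-𝒱₀ sharp 2-adic
Kolyvagin line (McCallum's Prop. 2.1 / Kolyvagin's "`H¹(K(E[p^M])/K, E[p^M]) = 0`" step, at the
prime `p = 2`, in the tree's currency): for every number field `F` in which `x³ = 432p²` has no root,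
every `F`-model `B` of `E_p : y² = x³ − 432p²` and every `M ≥ 1`,

  `res : H¹(F, E_p[2^M]) → H¹(F(E_p[2^M]), E_p[2^M])` is injective.

Proof.  `E[2^M]` is a `ℤ[ω]/2^M`-module through the complex multiplication
`[ω] : (x, y) ↦ (ωx, y)` (x1b's `SylvesterTwoCMNormForm.exists_omegaRot`, transported to `B` along
the `Γ_F`-equivariant `geomPointsEquiv`), free of rank one (`EisensteinTorsion.exists_lin_eq`:
order `4^M`, a point of order `2^M`).  The subgroup `Γ' = Γ_{F(ω)} ⊴ Γ_F` acts `ℤ[ω]`-linearly, hence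
through the COMMUTATIVE ring `ℤ[ω]/2^M` (`EisensteinTorsion.comp_comm_of_commute`), so any
`z ∈ Γ'` commutes with `Γ'` modulo `Gal(F̄/F(E[2^M]))`; and a `z ∈ Γ'` moving a `2`-torsion point
(`x³ = 432p²` has no root in `F(ω)` either, by degrees `3 ∤ [F(ω):F] ≤ 2`) has no non-zero fixed
vector on `E[2^M]` (`EisensteinTorsion.eq_zero_of_apply_eq_self_of_commute`: `2` is inert in `ℤ[ω]`).
Sah's lemma RELATIVE TO `Γ'` (`galoisCohomology.res_one_injective_of_normal_of_forall_fixed_eq_zero`)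
concludes (when `ω ∉ F` the one-step Sah lemma fails: the centre of `Gal(F(E[2^M])/F)` is scalar).

NOT the crux (the sharp 2-adic Kolyvagin bound off 𝒱₀ stays open): only its `H¹`-vanishing step.
-/

noncomputable section

open scoped Classical
open Field WeierstrassCurve Literature.NumberTheory.EllipticCurves
  Literature.NumberTheory.GaloisRepresentations

set_option autoImplicit false
set_option linter.dupNamespace false

namespace Summit.BirchSwinnertonDyer.BirchSwinnertonDyer.Theorems.SylvesterTwoUpper

universe u

/-! ## §1 Field-theoretic inputs over `F̄` -/

section FieldInputs

variable {F : Type u} [Field F] [CharZero F]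

/-- The roots of `X² + X + 1` are `ω` and `−ω − 1 = ω²`. [folklore] -/
theorem eq_or_eq_of_sq_add_self_add_one {L : Type*} [Field L] {ω r : L} (hω : ω ^ 2 + ω + 1 = 0)
    (hr : r ^ 2 + r + 1 = 0) : r = ω ∨ r = -ω - 1 := by
  have h : (r - ω) * (r - (-ω - 1)) = 0 := by linear_combination hr - hω
  rcases mul_eq_zero.mp h with h | h
  · exact Or.inl (sub_eq_zero.mp h)
  · exact Or.inr (sub_eq_zero.mp h)

omit [CharZero F] in
/-- **The stabiliser `Γ_{F(ω)}` of a primitive cube root of unity is normal in `Γ_F`** (every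
`τ ∈ Γ_F` maps `ω` to `ω` or `ω²`, both fixed by the stabiliser). [folklore] -/
theorem stabilizer_omega_normal {ω : AlgebraicClosure F} (hω : ω ^ 2 + ω + 1 = 0) :
    (MulAction.stabilizer (absoluteGaloisGroup F) ω).Normal := by
  refine ⟨fun σ hσ τ => ?_⟩
  rw [MulAction.mem_stabilizer_iff] at hσ ⊢
  rw [mul_smul, mul_smul]
  have hr : (τ⁻¹ • ω) ^ 2 + τ⁻¹ • ω + 1 = 0 := by
    have h := congrArg (fun x => τ⁻¹ • x) hω
    simpa only [smul_add, smul_pow', smul_one, smul_zero] using h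
  rcases eq_or_eq_of_sq_add_self_add_one hω hr with h | h
  · rw [h, hσ]
    exact (inv_smul_eq_iff.mp h).symm
  · have hσ' : σ • (-ω - 1) = -ω - 1 := by rw [smul_sub, smul_neg, smul_one, hσ]
    rw [h, hσ']
    exact (inv_smul_eq_iff.mp h).symm

/-- **`x³ = c` has no root in `F(ω)` if it has none in `F`** (`[F(∛c):F] = 3` does not divide
`[F(ω):F] ≤ 2`), in the form: some `σ ∈ Γ_F` fixes `ω` and moves `∛c`. [folklore] -/
theorem exists_smul_omega_eq_and_smul_ne {c : F} (hc : ∀ x : F, x ^ 3 ≠ c)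
    {ω x₀ : AlgebraicClosure F} (hω : ω ^ 2 + ω + 1 = 0)
    (hx₀ : x₀ ^ 3 = algebraMap F (AlgebraicClosure F) c) :
    ∃ σ : absoluteGaloisGroup F, σ • ω = ω ∧ σ • x₀ ≠ x₀ := by
  haveI : IsGalois F (AlgebraicClosure F) := {}
  set L : IntermediateField F (AlgebraicClosure F) := IntermediateField.adjoin F {ω} with hL
  -- `x₀ ∉ F(ω)` by degrees
  have hωint : IsIntegral F ω := by
    refine ⟨Polynomial.X ^ 2 + Polynomial.X + 1, by monicity!, ?_⟩
    simp only [Polynomial.eval₂_add, Polynomial.eval₂_X_pow, Polynomial.eval₂_X,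
      Polynomial.eval₂_one, hω]
  have hLfin : Module.finrank F L ≤ 2 := by
    rw [hL, IntermediateField.adjoin.finrank hωint]
    have hp0 : (Polynomial.X ^ 2 + Polynomial.X + 1 : Polynomial F) ≠ 0 := by
      apply Polynomial.Monic.ne_zero; monicity!
    have hdeg := minpoly.degree_le_of_ne_zero F ω hp0
      (show Polynomial.aeval ω (Polynomial.X ^ 2 + Polynomial.X + 1 : Polynomial F) = 0 by
        simp only [map_add, map_pow, Polynomial.aeval_X, map_one, hω])
    have h2 : (Polynomial.X ^ 2 + Polynomial.X + 1 : Polynomial F).natDegree ≤ 2 := by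
      compute_degree
    exact (Polynomial.natDegree_le_natDegree hdeg).trans h2
  haveI : FiniteDimensional F L := hL ▸ IntermediateField.adjoin.finiteDimensional hωint
  have hx₀L : x₀ ∉ L := by
    intro hmem
    have hle : IntermediateField.adjoin F {x₀} ≤ L :=
      IntermediateField.adjoin_simple_le_iff.mpr hmem
    have hirr : Irreducible (Polynomial.X ^ 3 - Polynomial.C c : Polynomial F) := by
      have hmon : (Polynomial.X ^ 3 - Polynomial.C c : Polynomial F).Monic :=
        Polynomial.monic_X_pow_sub_C c three_ne_zero
      have hnd : (Polynomial.X ^ 3 - Polynomial.C c : Polynomial F).natDegree = 3 :=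
        Polynomial.natDegree_X_pow_sub_C
      refine (hmon.irreducible_iff_roots_eq_zero_of_degree_le_three (by rw [hnd]; norm_num)
        (by rw [hnd])).mpr ?_
      refine Multiset.eq_zero_of_forall_notMem fun a ha => ?_
      rw [Polynomial.mem_roots hmon.ne_zero, Polynomial.IsRoot, Polynomial.eval_sub,
        Polynomial.eval_pow, Polynomial.eval_X, Polynomial.eval_C, sub_eq_zero] at ha
      exact hc a ha
    have hx₀int : IsIntegral F x₀ := by
      refine ⟨Polynomial.X ^ 3 - Polynomial.C c, Polynomial.monic_X_pow_sub_C c three_ne_zero, ?_⟩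
      simp only [Polynomial.eval₂_sub, Polynomial.eval₂_X_pow, Polynomial.eval₂_C, hx₀, sub_self]
    have hmin : minpoly F x₀ = Polynomial.X ^ 3 - Polynomial.C c := by
      refine (minpoly.eq_of_irreducible_of_monic hirr ?_
        (Polynomial.monic_X_pow_sub_C c three_ne_zero)).symm
      simp only [map_sub, map_pow, Polynomial.aeval_X, Polynomial.aeval_C, hx₀, sub_self]
    have h3 : Module.finrank F (IntermediateField.adjoin F {x₀}) = 3 := by
      rw [IntermediateField.adjoin.finrank hx₀int, hmin, Polynomial.natDegree_X_pow_sub_C]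
    have hdvd := IntermediateField.finrank_dvd_of_le_right hle
    rw [h3] at hdvd
    have hpos : 0 < Module.finrank F L := Module.finrank_pos
    omega
  -- Galois correspondence: `L` is the fixed field of its fixing group
  have hfix : IntermediateField.fixedField L.fixingSubgroup = L :=
    InfiniteGalois.fixedField_fixingSubgroup L
  have hωL : ω ∈ L := hL ▸ IntermediateField.mem_adjoin_simple_self F ω
  rw [← hfix, IntermediateField.mem_fixedField_iff] at hx₀L
  by_contra hall
  apply hx₀L
  intro f hf
  rw [IntermediateField.mem_fixingSubgroup_iff] at hf
  by_contra hne
  exact hall ⟨f, hf ω hωL, hne⟩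

end FieldInputs

/-! ## §2 The complex multiplication `[ω]` on the geometric points of an `F`-model of `y² = x³ − c` -/

section Omega

variable {F : Type u} [Field F] {V : WeierstrassCurve F}
  (h1 : V.a₁ = 0) (h2 : V.a₂ = 0) (h3 : V.a₃ = 0) (h4 : V.a₄ = 0)
  {ω : AlgebraicClosure F} (hω : ω ^ 2 + ω + 1 = 0)

/-- Base change to `F̄` keeps `a₁ = 0`. [folklore] -/
theorem baseChange_a₁_eq_zero (h1 : V.a₁ = 0) : (V.baseChange (AlgebraicClosure F)).a₁ = 0 := by
  simp [WeierstrassCurve.baseChange, h1]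
/-- Base change to `F̄` keeps `a₂ = 0`. [folklore] -/
theorem baseChange_a₂_eq_zero (h2 : V.a₂ = 0) : (V.baseChange (AlgebraicClosure F)).a₂ = 0 := by
  simp [WeierstrassCurve.baseChange, h2]
/-- Base change to `F̄` keeps `a₃ = 0`. [folklore] -/
theorem baseChange_a₃_eq_zero (h3 : V.a₃ = 0) : (V.baseChange (AlgebraicClosure F)).a₃ = 0 := by
  simp [WeierstrassCurve.baseChange, h3]
/-- Base change to `F̄` keeps `a₄ = 0`. [folklore] -/
theorem baseChange_a₄_eq_zero (h4 : V.a₄ = 0) : (V.baseChange (AlgebraicClosure F)).a₄ = 0 := by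
  simp [WeierstrassCurve.baseChange, h4]

/-- **`[ω]` commutes with every `σ ∈ Γ_F` fixing `ω`**: `σ([ω]P) = [ω](σP)` on `E(F̄)` for a
Mordell equation over `F` and any map `θ` acting by `(x, y) ↦ (ωx, y)` with `θ 𝒪 = 𝒪`
(the endomorphism `[ω]` is defined over `F(ω)`). [folklore] -/
theorem smul_omegaRot_of_smul_omega {θ : geomPoints V → geomPoints V} (hθ0 : θ 0 = 0)
    (hθ : ∀ (x y : AlgebraicClosure F) (h : (V.baseChange (AlgebraicClosure F)).toAffine.Nonsingular x y),
      θ (.some x y h) = .some (ω * x) y (SylvesterTwoCMNormForm.nonsingular_omega_mul hω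
        (baseChange_a₁_eq_zero h1) (baseChange_a₂_eq_zero h2) (baseChange_a₃_eq_zero h3)
        (baseChange_a₄_eq_zero h4) h))
    (σ : absoluteGaloisGroup F) (hσ : σ • ω = ω) (P : geomPoints V) :
    σ • θ P = θ (σ • P) := by
  have hσ' : ((show AlgebraicClosure F ≃ₐ[F] AlgebraicClosure F from σ) :
      AlgebraicClosure F →ₐ[F] AlgebraicClosure F) ω = ω := hσ
  rcases P with _ | ⟨x, y, h⟩
  · change σ • θ 0 = θ (σ • 0)
    rw [hθ0, smul_zero, hθ0]
  · have eL : σ • θ (.some x y h) = Affine.Point.map ((show AlgebraicClosure F ≃ₐ[F]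
        AlgebraicClosure F from σ) : AlgebraicClosure F →ₐ[F] AlgebraicClosure F)
        (θ (.some x y h)) := rfl
    have eR : (σ • (show geomPoints V from .some x y h)) = Affine.Point.map
        ((show AlgebraicClosure F ≃ₐ[F] AlgebraicClosure F from σ) :
          AlgebraicClosure F →ₐ[F] AlgebraicClosure F) (.some x y h) := rfl
    change σ • θ (.some x y h) = θ (σ • (show geomPoints V from .some x y h))
    rw [eL, eR, hθ x y h, Affine.Point.map_some, Affine.Point.map_some, hθ]
    simp only [map_mul, hσ']

variable [V.IsElliptic]
include h1 h2 h3 h4 hω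

/-- **`[ω]` on `E(F̄)` for an `F`-model `B ≅ V` of a Mordell equation**, as an additive endomorphism
`θ` of `geomPoints B` with `θ² + θ + 1 = 0` commuting with `Γ_{F(ω)}`: x1b's
`SylvesterTwoCMNormForm.exists_omegaRot` on `V/F̄`, transported along the `Γ_F`-equivariant
isomorphism `geomPointsEquiv B C : E_B(F̄) ≃ E_V(F̄)` (`C • B = V`).
[cite: HuShuYin2019, p. 4 (the complex multiplication `[ω](x,y) = (ωx, y)`)] -/
theorem exists_omega_geomPoints [CharZero F] {B : WeierstrassCurve F} {C : VariableChange F}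
    (hCB : C • B = V) :
    ∃ θ : geomPoints B →+ geomPoints B, (∀ x, θ (θ x) + θ x + x = 0) ∧
      ∀ σ : absoluteGaloisGroup F, σ • ω = ω → ∀ x, σ • θ x = θ (σ • x) := by
  subst hCB
  have h1' := baseChange_a₁_eq_zero (V := C • B) h1
  have h2' := baseChange_a₂_eq_zero (V := C • B) h2
  have h3' := baseChange_a₃_eq_zero (V := C • B) h3
  have h4' := baseChange_a₄_eq_zero (V := C • B) h4
  obtain ⟨θ', hθ'⟩ := SylvesterTwoCMNormForm.exists_omegaRot hω h1' h2' h3' h4'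
  have hω1 : ω ≠ 1 := by
    rintro rfl
    norm_num at hω
  -- `θ'` as an additive endomorphism of the synonym `geomPoints (C • B)`
  let θ₁ : geomPoints (C • B) →+ geomPoints (C • B) := θ'.toAddMonoidHom
  have hθ₁0 : (θ₁ : geomPoints (C • B) → geomPoints (C • B)) 0 = 0 := map_zero θ'
  have hθ₁ : ∀ (x y : AlgebraicClosure F)
      (h : ((C • B).baseChange (AlgebraicClosure F)).toAffine.Nonsingular x y),
      (θ₁ : geomPoints (C • B) → geomPoints (C • B)) (.some x y h) = .some (ω * x) y
        (SylvesterTwoCMNormForm.nonsingular_omega_mul hω h1' h2' h3' h4' h) := hθ'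
  have hrel : ∀ Q : geomPoints (C • B), θ₁ (θ₁ Q) + θ₁ Q + Q = 0 := fun Q =>
    SylvesterTwoCMNormForm.omegaRot_omegaRot_add_omegaRot_add hω h1' h2' h3' h4'
      (θ := (θ₁ : geomPoints (C • B) → geomPoints (C • B))) hθ₁0 hθ₁ hω1 Q
  have hcomm : ∀ σ : absoluteGaloisGroup F, σ • ω = ω → ∀ Q : geomPoints (C • B),
      σ • θ₁ Q = θ₁ (σ • Q) := fun σ hσ Q =>
    smul_omegaRot_of_smul_omega h1 h2 h3 h4 hω (θ := (θ₁ : geomPoints (C • B) → geomPoints (C • B)))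
      hθ₁0 hθ₁ σ hσ Q
  set e : geomPoints B ≃+ geomPoints (C • B) := geomPointsEquiv B C with he
  have hes : ∀ (σ : absoluteGaloisGroup F) (Q : geomPoints (C • B)),
      σ • e.symm Q = e.symm (σ • Q) := fun σ Q => by
    apply e.injective
    rw [he, geomPointsEquiv_smul, AddEquiv.apply_symm_apply, AddEquiv.apply_symm_apply]
  refine ⟨e.symm.toAddMonoidHom.comp (θ₁.comp e.toAddMonoidHom), fun x => ?_, fun σ hσ x => ?_⟩
  · change e.symm (θ₁ (e (e.symm (θ₁ (e x))))) + e.symm (θ₁ (e x)) + x = 0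
    rw [e.apply_symm_apply]
    have h' := congrArg e.symm (hrel (e x))
    rwa [map_add, map_add, map_zero, e.symm_apply_apply] at h'
  · change σ • e.symm (θ₁ (e x)) = e.symm (θ₁ (e (σ • x)))
    rw [hes, hcomm σ hσ, he, geomPointsEquiv_smul]

omit hω in
/-- **A `2`-torsion point of `y² = x³ − c` moved by `σ`**: for `x₀³ = c` in `F̄` and `σ x₀ ≠ x₀`, the
point `t = (x₀, 0)` of `V(F̄)` (transported to the model `B`) satisfies `2t = 0` and `σ t ≠ t`.
[folklore] -/
theorem exists_two_torsion_smul_ne [CharZero F] {B : WeierstrassCurve F} {C : VariableChange F}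
    (hCB : C • B = V) {c : F} (h6 : V.a₆ = -c) {x₀ : AlgebraicClosure F}
    (hx₀ : x₀ ^ 3 = algebraMap F (AlgebraicClosure F) c) (σ : absoluteGaloisGroup F)
    (hσ : σ • x₀ ≠ x₀) :
    ∃ t : geomPoints B, (2 : ℕ) • t = 0 ∧ σ • t ≠ t := by
  subst hCB
  haveI : ((C • B).baseChange (AlgebraicClosure F)).IsElliptic :=
    inferInstanceAs ((C • B).map (algebraMap F (AlgebraicClosure F))).IsElliptic
  have heq : ((C • B).baseChange (AlgebraicClosure F)).toAffine.Equation x₀ 0 := by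
    rw [Affine.equation_iff]
    simp only [WeierstrassCurve.baseChange, map_a₁, map_a₂, map_a₃, map_a₄, map_a₆, h1, h2, h3,
      h4, h6, map_zero, map_neg, hx₀]
    ring
  have hns : ((C • B).baseChange (AlgebraicClosure F)).toAffine.Nonsingular x₀ 0 :=
    Affine.equation_iff_nonsingular.mp heq
  have h2T : (2 : ℕ) • (Affine.Point.some x₀ 0 hns :
      ((C • B).baseChange (AlgebraicClosure F)).toAffine.Point) = 0 := by
    rw [two_nsmul_some_eq_zero_iff_eq_negY]
    simp [Affine.negY, WeierstrassCurve.baseChange, h1, h3]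
  set T : geomPoints (C • B) := Affine.Point.some x₀ 0 hns with hT
  have h2T' : (2 : ℕ) • T = 0 := h2T
  have hσT : σ • T ≠ T := by
    intro h
    apply hσ
    have h' : Affine.Point.map ((show AlgebraicClosure F ≃ₐ[F] AlgebraicClosure F from σ) :
        AlgebraicClosure F →ₐ[F] AlgebraicClosure F) (Affine.Point.some x₀ 0 hns) =
        Affine.Point.some x₀ 0 hns := h
    rw [Affine.Point.map_some, Affine.Point.some.injEq] at h'
    exact h'.1
  set e : geomPoints B ≃+ geomPoints (C • B) := geomPointsEquiv B C with he
  have hes : ∀ Q : geomPoints (C • B), σ • e.symm Q = e.symm (σ • Q) := fun Q => by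
    apply e.injective
    rw [he, geomPointsEquiv_smul, AddEquiv.apply_symm_apply, AddEquiv.apply_symm_apply]
  refine ⟨e.symm T, by rw [← map_nsmul, h2T', map_zero], fun h => hσT ?_⟩
  rw [hes] at h
  exact e.symm.injective h

end Omega

/-! ## §3 The restriction to the `2^M`-division field is injective -/

section Main

variable {F : Type u} [Field F] [NumberField F]

/-- **`H¹(F, E[2^M]) → H¹(F(E[2^M]), E[2^M])` is injective for every `F`-model `B` of a Mordell
curve `y² = x³ − c` with `∛c ∉ F`** (`M ≥ 1`).  Relative Sah lemma
(`galoisCohomology.res_one_injective_of_normal_of_forall_fixed_eq_zero`) with `Γ' = Γ_{F(ω)}`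
and `z` any element of `Γ'` moving `∛c`: `Γ'` acts on the free rank-one `ℤ[ω]/2^M`-module `E[2^M]`
through the commutative ring `ℤ[ω]/2^M` (`EisensteinTorsion.comp_comm_of_commute`), and `z` has no
non-zero fixed vector (`EisensteinTorsion.eq_zero_of_apply_eq_self_of_commute`).
[cite: McCallumLMS1991, Prop. 2.1 (the case p odd)] -/
theorem res_injective_divisionField_twoPow_of_mordell {c : F} (hc : ∀ x : F, x ^ 3 ≠ c)
    (B : WeierstrassCurve F) [B.IsElliptic] {C : VariableChange F}
    (hCB : C • B = ⟨0, 0, 0, 0, -c⟩) {M : ℕ} (hM : 1 ≤ M) :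
    Function.Injective (galoisCohomology.res (B.torsionGaloisModule ((2 ^ M : ℕ) : ℤ))
      (B.divisionField (2 ^ M)) 1) := by
  haveI : NeZero (2 ^ M : ℕ) := ⟨pow_ne_zero _ two_ne_zero⟩
  haveI hV : (C • B).IsElliptic := inferInstance
  -- a primitive cube root of unity and a cube root of `c` in `F̄`
  obtain ⟨ω, hω⟩ : ∃ ω : AlgebraicClosure F, ω ^ 2 + ω + 1 = 0 := by
    obtain ⟨ω, hω⟩ := IsAlgClosed.exists_root
      (Polynomial.X ^ 2 + Polynomial.X + 1 : Polynomial (AlgebraicClosure F))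
      (by rw [show (Polynomial.X ^ 2 + Polynomial.X + 1 : Polynomial (AlgebraicClosure F)).degree
        = 2 by compute_degree!]; norm_num)
    exact ⟨ω, by simpa [Polynomial.IsRoot] using hω⟩
  obtain ⟨x₀, hx₀⟩ : ∃ x₀ : AlgebraicClosure F, x₀ ^ 3 = algebraMap F (AlgebraicClosure F) c :=
    IsAlgClosed.exists_pow_nat_eq _ (by norm_num)
  -- `z ∈ Γ' = Γ_{F(ω)}` moving `x₀`
  obtain ⟨z, hzω, hzx⟩ := exists_smul_omega_eq_and_smul_ne hc hω hx₀
  haveI := stabilizer_omega_normal (F := F) hω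
  -- `[ω]` on `E_B(F̄)` and the `2`-torsion point
  obtain ⟨θ, hθrel, hθeq⟩ := exists_omega_geomPoints (V := C • B) (by rw [hCB]) (by rw [hCB])
    (by rw [hCB]) (by rw [hCB]) hω rfl
  obtain ⟨t, h2t, hzt⟩ := exists_two_torsion_smul_ne (V := C • B) (by rw [hCB]) (by rw [hCB])
    (by rw [hCB]) (by rw [hCB]) rfl (c := c) (by rw [hCB]) hx₀ z hzx
  -- the module `N = E[2^M]`
  set m : ℕ := 2 ^ M with hm
  haveI : Finite (geomTorsion B (m : ℤ)) := B.finite_geomTorsion_nat (NeZero.ne m)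
  have hmF : (m : F) ≠ 0 := by rw [hm]; exact_mod_cast pow_ne_zero M (two_ne_zero (α := F))
  obtain ⟨P₀, hP₀⟩ := WeierstrassCurve.exists_addOrderOf_eq (W := B) hmF
  have hcard : Nat.card (geomTorsion B (m : ℤ)) = 4 ^ M := by
    rw [hm, card_geomTorsion_two_pow B two_ne_zero M, pow_mul]
    norm_num
  -- `θ` restricted to `N`
  have hmem : ∀ P : geomPoints B, P ∈ geomTorsion B (m : ℤ) ↔ (m : ℤ) • P = 0 := fun P =>
    Submodule.mem_torsionBy_iff (m : ℤ) P
  have hθmem : ∀ T : geomTorsion B (m : ℤ), θ (T : geomPoints B) ∈ geomTorsion B (m : ℤ) := by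
    intro T
    rw [hmem, ← map_zsmul, (hmem _).mp T.2, map_zero]
  let θN : geomTorsion B (m : ℤ) →+ geomTorsion B (m : ℤ) :=
    { toFun := fun T => ⟨θ T, hθmem T⟩
      map_zero' := Subtype.ext (by simp)
      map_add' := fun T T' => Subtype.ext (by simp) }
  have hθN : ∀ T : geomTorsion B (m : ℤ), θN (θN T) + θN T + T = 0 := fun T =>
    Subtype.ext (hθrel T)
  -- the action of `Γ_F` on `N`, commuting with `θN` on `Γ'`
  have hg : ∀ σ : absoluteGaloisGroup F, σ • ω = ω → ∀ T : geomTorsion B (m : ℤ),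
      DistribSMul.toAddMonoidHom (geomTorsion B (m : ℤ)) σ (θN T) =
        θN (DistribSMul.toAddMonoidHom (geomTorsion B (m : ℤ)) σ T) := by
    intro σ hσ T
    apply Subtype.ext
    simp only [DistribSMul.toAddMonoidHom_apply, AddSubgroup.torsionBy.coe_smul]
    exact hθeq σ hσ T
  -- the `2`-torsion point inside `N`
  have htmem : t ∈ geomTorsion B (m : ℤ) := by
    rw [hmem, hm]
    obtain ⟨k, hk⟩ : ∃ k, M = k + 1 := ⟨M - 1, by omega⟩
    rw [hk, pow_succ, Nat.cast_mul, mul_zsmul]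
    have : ((2 : ℕ) : ℤ) • t = 0 := by rw [natCast_zsmul, h2t]
    rw [this, zsmul_zero]
  have h2t' : (2 : ℕ) • (⟨t, htmem⟩ : geomTorsion B (m : ℤ)) = 0 := Subtype.ext h2t
  have hzt' : DistribSMul.toAddMonoidHom (geomTorsion B (m : ℤ)) z ⟨t, htmem⟩ ≠ ⟨t, htmem⟩ :=
    fun h => hzt (congrArg Subtype.val h)
  -- the relative Sah lemma
  refine galoisCohomology.res_one_injective_of_normal_of_forall_fixed_eq_zero
    (B.torsionGaloisModule (m : ℤ)) (B.divisionField m)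
    (MulAction.stabilizer (absoluteGaloisGroup F) ω) (z := z) hzω ?_ ?_
  · -- `z` commutes with `Γ'` modulo `Gal(F̄/F(E[2^M]))`
    intro σ hσ
    rw [QuotientGroup.eq, mem_absGaloisFixingSubgroup_iff]
    intro x hx
    refine (B.mem_divisionField_iff m).mp hx _ fun T => ?_
    rw [mul_smul, inv_smul_eq_iff, mul_smul, mul_smul]
    have h := EisensteinTorsion.comp_comm_of_commute θN hθN hcard hP₀
      (DistribSMul.toAddMonoidHom _ z) (DistribSMul.toAddMonoidHom _ σ)
      (hg z hzω) (hg σ hσ) T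
    simpa only [DistribSMul.toAddMonoidHom_apply] using h
  · -- `z` has no non-zero fixed vector on `E[2^M]`
    intro T hT
    rw [torsionGaloisModule_apply_apply] at hT
    exact EisensteinTorsion.eq_zero_of_apply_eq_self_of_commute θN hθN hcard hP₀ hM
      (DistribSMul.toAddMonoidHom _ z) (hg z hzω) (MulAction.injective z) h2t' hzt' hT

/-- **The registered stub `stub_res_injective_divisionField_twoPow` of crux `UpperOffV0HSY`
(item 19581)**: for `p ≡ 4, 7 (mod 9)` prime, every number field `F` with no root of
`x³ = 432p²`, every `F`-model `B` of `E_p : y² = x³ − 432p²` and every `M ≥ 1`, the restriction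
`H¹(F, E_p[2^M]) → H¹(F(E_p[2^M]), E_p[2^M])` is injective (McCallum's Prop. 2.1 at the prime
`2` for the HSY family; the hypotheses on `p` are not used). [cite: McCallumLMS1991, Prop. 2.1] -/
theorem stub_res_injective_divisionField_twoPow :
    ∀ (p : ℕ), p.Prime → (p % 9 = 4 ∨ p % 9 = 7) → ∀ (F : Type) [Field F] [NumberField F],
      (∀ x : F, x ^ 3 ≠ 432 * (p : F) ^ 2) → ∀ (B : WeierstrassCurve F) [B.IsElliptic],
      (∃ C : VariableChange F, C • B = ⟨0, 0, 0, 0, -432 * (p : F) ^ 2⟩) → ∀ (M : ℕ), 1 ≤ M →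
      Function.Injective (galoisCohomology.res (B.torsionGaloisModule ((2 ^ M : ℕ) : ℤ))
        (B.divisionField (2 ^ M)) 1) := by
  intro p _ _ F _ _ hc B _ hB M hM
  obtain ⟨C, hCB⟩ := hB
  exact res_injective_divisionField_twoPow_of_mordell hc B (hCB.trans (by ring_nf)) hM

end Main

end Summit.BirchSwinnertonDyer.BirchSwinnertonDyer.Theorems.SylvesterTwoUpper

end
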